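/-
Copyright: lit-balaban Phase-2 proof seat p09 (gen 3).  Statement-level skeleton of a published paper; no proof claims beyond what the
kernel checks below.
-/
import Literature.MathematicalPhysics.QuantumFieldTheory.BalabanImbrieJaffe1984to88.BIJ85UnitPropagator433
import Literature.MathematicalPhysics.QuantumFieldTheory.BalabanImbrieJaffe1984to88.BIJ85Sect4Statements
import Literature.MathematicalPhysics.QuantumFieldTheory.BalabanImbrieJaffe1984to88.BIJ85Sect7Statements
import Literature.MathematicalPhysics.QuantumFieldTheory.Balaban1983to89.B4Sect5Torus
import Literature.MathematicalPhysics.QuantumFieldTheory.Balaban1983to89.B6FromB4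

/-!
# `BalabanImbrieJaffe1984to88.BIJ85Ineq434Proof` — T. Bałaban, J. Imbrie, A. Jaffe, *Renormalization of the Higgs model: minimizers,
propagators and the stability of mean field theory*, Commun. Math. Phys. **97** (1985) 299–329 [BalabanImbrieJaffe1985]: Sect. 4.3
p. 311 — **(4.3.4)** *"C^{(k)} is well defined and is bounded in norm ‖C^{(k)}‖ ≤ c"* and **(4.3.5)** *"|C^{(k)}(x, y)| ≤ a exp(−b|x − y|)"*
for the (4.3.3) propagator, PROVED ALONG THE ROUTE THE PAPER CITES (*"established by Balaban [6II]"* = [Balaban1984PropagatorsII]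
pp. 249–250: the lower bound (2.153) and the representation (2.155)–(2.156) `C^{(k)}_Λ = C(C*Δ_kC)⁻¹C*` with a short-ranged `C`, then
*"the general theorem on unit lattice operators in [7]"* = [Balaban1983RegularityDecay] Sect. 5, p. 325 (7.2.3)) — the Sect. 5 theorem
entering AS PROVED in the tree (`…Balaban1983to89.B4Sect5Torus.inv_decay`)

statement-level skeleton of published theorems with citation tags; proofs where landed; nothing here is a claim about the Yang–Mills mass gap

PDF held: `paper:balaban1985-cmp97-bij-higgs-minimizers` (journal page = PDF page + 298).  Pages read as images: p. 311 [PDF 13]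
(`run/shared/lean/pub/pub-balaban/t4/b2b-balaban-t4-lit2/renders/bij1985/1985-cmp97-bij-higgs-minimizers-p013-x2.png`), p. 325 [PDF 27]
(`…-p027-x2.png`); [Balaban1984PropagatorsII] p. 250 and [Balaban1983RegularityDecay] p. 594 through the verbatim quotations in the
headers of `…Balaban1983to89.B6FromB4` and `…Balaban1983to89.B4Sect5Torus` (pub-balaban cell; page renders cited there).

CITATION HEADER (lean-in-tree rule).  Part of the lit-balaban TYPED SKELETON (HOME `run/shared/lean/pub/lit-balaban/`), Phase-2 seat p09
(gen 3; gens 1–2 = `BIJ85AxialPropagator411`, `BIJ85AxialMinimizer413`, `BIJ85SigmaForm421`, `BIJ85UnitPropagator433`, `BIJ85Prop521Proof`);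
rows **C1.Eq4.3.4-4.3.5** (typed `BIJ85Sect4Statements.GaugeRG.Ineq434/Ineq435`, status *typed p239474 — claims by reference to B6*) and
the (7.2.3) sentence of row **C1.Eq7.2.3** of `HOME/SKELETON.md` (reader file `HOME/lit-balaban-r15/ROWS-C1.md`, owner r15, referee ref-5).

THE PRINTED TEXT (verbatim).  p. 311 [PDF 13]: *"The action Δ_k yields the unit lattice propagator C^{(k)}, defined as follows:
exp(½⟨J, C^{(k)}J⟩) = (Z^{(k)})^{−1}∫𝒟Bδ(QB)δ_{Ax}(B)exp(−½⟨B, Δ_kB⟩ + ⟨B, J⟩). (4.3.3) The actions Δ_k and propagators C^{(k)} were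
studied by Balaban [6II] who established that C^{(k)} is well defined and is bounded in norm ‖C^{(k)}‖ ≤ c (4.3.4) uniformly in k.
Furthermore C^{(k)} has a kernel which decays exponentially, uniformly in k. |C^{(k)}(x, y)| ≤ a exp(−b|x − y|). (4.3.5)"*; p. 325
[PDF 27]: *"The unit lattice propagator C^{(k)} also has exponential decay, |C^{(k)}_{μν}(x, y)| ≤ Me^{−δ|x−y|}, (7.2.3) for x, y ∈ T₁^{(k)}. This
inequality follows from the bound (2.157) in [6II] and from the general theorem on unit lattice operators in [7]."*  [6II] =
[Balaban1984PropagatorsII] p. 249–250 [PDF 27–28]: *"Using (2.118) and (2.128) we get ⟨B, Δ_kB⟩ ≥ (γ₀/12d²)L^{−d−1}‖B‖², or Δ_k ≥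
(γ₀/12d²)L^{−d−1} (2.153) on the subspace of B satisfying: QB = 0, B(Γ_{y,x}) = 0 for x ∈ B(y). … If we denote the remaining variables by
B′, then we can write B = CB′, where C is a linear operator … (2.155) hence C^{(k)}_Λ = C(C*Δ_kC)⁻¹C*. (2.156) … The inequality (2.153) implies
⟨B′, C*Δ_kCB′⟩ ≥ (γ₀/12d²)L^{−d−1}‖CB′‖² ≥ γ′₀‖B′‖², (2.157) where γ′₀ = (γ₀/12d²)L^{−d−1}. C is a short-ranged operator, so C*Δ_kC has the same
exponential decay as Δ_k. Now we may apply the theory developed in Sect. 5 of [3] on unit lattice operators. It gives us an exponential decay,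
and all the other properties, for the operator (C*Δ_kC)⁻¹, hence for C^{(k)}_Λ also."*

WHAT IS PROVED, and how (the Euclidean framework of the (4.3.3) file: finite-dimensional real inner product spaces; `W` = the unit-lattice
constraint subspace = support of `δ(QB)δ_{Ax}(B)`; `T = ∂H_{k,Ax}` so that `⟨B, Δ_kB⟩ = ‖TB‖²` (4.3.1)–(4.3.2) and `Δ_k = T^*T =
BIJ85UnitPropagator433.deltaOp`; the propagator `C^{(k)}` = `BIJ85AxialPropagator411.axialPropagator W T` = `BIJ85UnitPropagator433.unitPropagator`,
the operator PROVED to satisfy (4.3.3) in gen 2).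
* §1 **(4.3.4)**: the GALERKIN characterisation of `C^{(k)}J` (`axialPropagator_galerkin`: `C^{(k)}J ∈ W` and `⟨Tv, TC^{(k)}J⟩ = ⟨v, J⟩` for all
  `v ∈ W`; uniqueness `galerkin_unique`), and from the [6II] lower bound (2.153) in the shape `γ‖B‖² ≤ ⟨B, Δ_kB⟩` on `W` (hypothesis `hcoer`):
  no zero modes (`noZeroModes_of_coercive`, whence *"C^{(k)} is well defined"* = (4.3.3) holds with `Z^{(k)} > 0`, `unitPropagator_wellDefined`),
  and *"bounded in norm ‖C^{(k)}‖ ≤ c"* with `c = γ⁻¹` (`norm_axialPropagator_le`, the operator norm `opNorm_axialPropagator_le`,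
  `inner_axialPropagator_le`, `norm_unitPropagator_le`) —
  *"uniformly in k"* exactly when γ is, as (2.153) states (γ = (γ₀/12d²)L^{−d−1}).
* §2 **[6II] (2.156)** `C^{(k)} = C(C*Δ_kC)⁻¹C*` for EVERY linear parametrisation `B = CB′` of `W` (`axialPropagator_eq_of_reduced`: a solution of the
  reduced equation `C*Δ_kC x = C*J` gives `Cx = C^{(k)}J`; invertibility of `C*Δ_kC` from (2.157), `reducedOp_injective`).
* §3 **(4.3.5)/(7.2.3)** in coordinates (`W ⊆ ℝⁿ` = `EuclideanSpace ℝ n`, `n` the unit-lattice bonds with positions in a metric space, `C` a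
  MATRIX `Matrix n m ℝ`): the kernel `C^{(k)}(x, y) := (C^{(k)}δ_y)(x)` IS the matrix `C(CᵀΔ_kC)⁻¹Cᵀ` (`kernel_eq_2156`), `CᵀΔ_kC` satisfies condition
  (5.6) of [7] (`hyp56_reduced`, via the pub-balaban cell's `B6FromB4.sandwich_decay/_lowerBound/_isSymm` = the sentence *"C is a short-ranged
  operator, so C*Δ_kC has the same exponential decay as Δ_k"* with its constant), and THE PROVED Sect. 5 theorem of [7]
  (`B4Sect5Torus.inv_decay`, finite Combes–Thomas, constants chosen before the instance) gives **`kernel_decay`**: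
  `|C^{(k)}(x, y)| ≤ a·e^{−b·dist(x,y)}` with `a = (2/γ)e^{2br}m_C²`, `b = B4Sect5Torus.rate K γ (c₀e^{2δ₀r}m_C²) δ₀` — functions of the constants
  `γ` (2.153), `(c₀, δ₀)` (kernel decay of Δ_k), `r, m_C` (range and ℓ¹-size of `C`) and of the lattice-sum profile `K` ONLY, hence
  *"uniformly in k"* whenever these are; `kernel_decay_unitPropagator` is the same for `unitPropagator`.
* §4 KNITTING to the typed decls of record (r15's abstract carriers): `ineq434_of_opNorm : S.Ineq434 γ⁻¹` for every
  `S : BIJ85Sect4Statements.GaugeRG` whose `normCk` is the operator norm of the (4.3.3) propagator, `ineq435_of_kernel : S.Ineq435 a b` for every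
  `S` whose `Ck`/`distU` are its kernel in bond coordinates / the bond distance, and `ineq723_of_kernel : Kd.Ineq723 M δ` for every
  `Kd : BIJ85Sect7Statements.KernelData` whose `C μ ν x y` is that kernel at the bonds `(x, μ)`, `(y, ν)`.
* §5 (v1.1) p. 325 *"also holds for propagators with Dirichlet boundary conditions outside a domain Λ, uniformly in Λ"*:
  `kernel_decay_dirichlet` — the propagator of every sub-parametrised subspace `C(ℝ^{Λ′}) ⊆ W` obeys (4.3.5) with THE SAME `(a, b)`
  (reduced operator = compression `(CᵀΔ_kC)_{Λ′}`, `subparam_reduced`; uniformity of [7] Sect. 5 over compressions,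
  `B4Sect5Torus.inv_submatrix_decay`); `norm_axialPropagator_le_of_le` — (4.3.4) for every subspace with the same `c`.
HONEST SCOPE.  The three [6II] inputs — (2.153) (`hcoer`), the exponential decay of the kernel of `Δ_k` (`hΔ`), and the short-ranged
parametrisation `B = CB′` with `‖CB′‖ ≥ ‖B′‖` ((2.155); `hrange`, `hrow`, `hcol`, `hiso`) — enter as HYPOTHESES OF THE PRINTED SHAPE; they are
rows B6.Eq2.152 / B6.Eq2.154 / B6.Eq2.157 of the skeleton (kernel-proved by the pub-balaban cell on ITS torus carrier,
`…Balaban1983to89.B6Cov2156TorusDelK`, not transported to the `Setup`/`LatticeFieldCalculus` torus instance of (4.3.3)).  The Sect. 5 theorem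
of [7] is NOT a hypothesis.  No `def`, no new `Prop`; nothing of the paper beyond the kernel-checked statements below is asserted.
Unit `lit-balaban-p09` (literature-prover-lit-balaban-p09-g3-0), 2026-08-21.
-/

namespace Literature.MathematicalPhysics.QuantumFieldTheory.BalabanImbrieJaffe1984to88.BIJ85Ineq434Proof

open scoped RealInnerProductSpace BigOperators Matrix
open Literature.MathematicalPhysics.QuantumFieldTheory.Balaban1983to89
open BIJ85AxialPropagator411 BIJ85UnitPropagator433

noncomputable section

/-! ## §1  The Galerkin characterisation of the (4.3.3) second moment; (4.3.4) from the [6II] lower bound (2.153) -/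

section Galerkin

variable {E₁ F' : Type*} [NormedAddCommGroup E₁] [InnerProductSpace ℝ E₁] [FiniteDimensional ℝ E₁]
  [NormedAddCommGroup F'] [InnerProductSpace ℝ F'] [FiniteDimensional ℝ F']

/-- plumbing for (4.3.3): `⟨v, (S^*S)w⟩ = ⟨Sv, Sw⟩` for `S = T∘ι_W` (the operator `formOp` of the (4.1.1)/(4.3.3) Gaussian).
[cite: BalabanImbrieJaffe1985, (4.3.3) p.311] -/
theorem inner_formOp_eq (W : Submodule ℝ E₁) (T : E₁ →ₗ[ℝ] F') (v w : W) :
    ⟪v, formOp (T ∘ₗ W.subtype) w⟫ = ⟪T (v : E₁), T (w : E₁)⟫ := by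
  unfold formOp
  rw [LinearMap.comp_apply, LinearMap.adjoint_inner_right]
  rfl

omit [FiniteDimensional ℝ E₁] [FiniteDimensional ℝ F'] in
/-- plumbing for (4.3.3): no zero modes of `T` on `W` ⇔ injectivity of `T∘ι_W`. [cite: BalabanImbrieJaffe1985, (4.3.3) p.311] -/
theorem injective_of_noZeroModes {W : Submodule ℝ E₁} {T : E₁ →ₗ[ℝ] F'} (hT : ∀ w : W, T (w : E₁) = 0 → w = 0) :
    Function.Injective (T ∘ₗ W.subtype) := by
  intro a b h
  have h0 : (T ∘ₗ W.subtype) (a - b) = 0 := by rw [map_sub, h, sub_self]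
  exact sub_eq_zero.1 (hT _ h0)

/-- `C^{(k)}J` lies in the constraint subspace `W` (the Gaussian (4.3.3) lives on `δ(QB)δ_{Ax}(B)`). [cite: BalabanImbrieJaffe1985, (4.3.3) p.311] -/
theorem axialPropagator_mem (W : Submodule ℝ E₁) (T : E₁ →ₗ[ℝ] F') (J : E₁) : axialPropagator W T J ∈ W := by
  unfold axialPropagator
  simp only [LinearMap.comp_apply]
  exact Submodule.coe_mem _

/-- **The Galerkin equation of (4.3.3)**: `C^{(k)}J` is the element `u ∈ W` with `⟨TB, Tu⟩ = ⟨B, J⟩` for all `B ∈ W` — i.e. `Δ_ku = J` in the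
weak sense on the constraint subspace (the second moment of `exp(−½⟨B, Δ_kB⟩ + ⟨B, J⟩)` over `W`; no zero modes of `T = ∂H_{k,Ax}` on `W`).
[cite: BalabanImbrieJaffe1985, (4.3.3) p.311] -/
theorem axialPropagator_galerkin {W : Submodule ℝ E₁} {T : E₁ →ₗ[ℝ] F'} (hT : ∀ w : W, T (w : E₁) = 0 → w = 0)
    (J : E₁) (v : W) : ⟪T (v : E₁), T (axialPropagator W T J)⟫ = ⟪(v : E₁), J⟫ := by
  have hS := injective_of_noZeroModes hT
  have key : axialPropagator W T J =
      ((formInv (T ∘ₗ W.subtype) (LinearMap.adjoint W.subtype J) : W) : E₁) := rfl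
  rw [key, ← inner_formOp_eq W T v, formOp_formInv hS, LinearMap.adjoint_inner_right]
  rfl

omit [FiniteDimensional ℝ E₁] [FiniteDimensional ℝ F'] in
/-- Uniqueness for the Galerkin equation on `W` (no zero modes): two elements of `W` with the same pairings `⟨TB, T·⟩` against `W` coincide.
[cite: BalabanImbrieJaffe1985, (4.3.3) p.311] -/
theorem galerkin_unique {W : Submodule ℝ E₁} {T : E₁ →ₗ[ℝ] F'} (hT : ∀ w : W, T (w : E₁) = 0 → w = 0)
    {J u₁ u₂ : E₁} (h₁ : u₁ ∈ W) (h₂ : u₂ ∈ W)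
    (hg₁ : ∀ v : W, ⟪T (v : E₁), T u₁⟫ = ⟪(v : E₁), J⟫) (hg₂ : ∀ v : W, ⟪T (v : E₁), T u₂⟫ = ⟪(v : E₁), J⟫) : u₁ = u₂ := by
  have hd : ∀ v : W, ⟪T (v : E₁), T (u₁ - u₂)⟫ = 0 := fun v => by
    rw [map_sub, inner_sub_right, hg₁, hg₂, sub_self]
  have h0 : T (u₁ - u₂) = 0 := by
    have h := hd ⟨u₁ - u₂, W.sub_mem h₁ h₂⟩
    simpa only [real_inner_self_eq_norm_sq, pow_eq_zero_iff, ne_eq, OfNat.ofNat_ne_zero, not_false_eq_true,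
      norm_eq_zero] using h
  have h := hT ⟨u₁ - u₂, W.sub_mem h₁ h₂⟩ h0
  exact sub_eq_zero.1 (congrArg Subtype.val h)

omit [FiniteDimensional ℝ E₁] [FiniteDimensional ℝ F'] in
/-- The [6II] lower bound (2.153) `⟨B, Δ_kB⟩ ≥ γ‖B‖²` on the constraint subspace (γ > 0) excludes zero modes of `T = ∂H_{k,Ax}` on `W` —
the hypothesis under which (4.3.3) was PROVED for the operator formula (`isUnitPropagator_unitPropagator`). [cite: Balaban1984PropagatorsII, (2.153) p.249] -/
theorem noZeroModes_of_coercive {W : Submodule ℝ E₁} {T : E₁ →ₗ[ℝ] F'} {γ : ℝ} (hγ : 0 < γ)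
    (hcoer : ∀ w : W, γ * ‖(w : E₁)‖ ^ 2 ≤ ‖T (w : E₁)‖ ^ 2) (w : W) (hw : T (w : E₁) = 0) : w = 0 := by
  have h := hcoer w
  rw [hw, norm_zero] at h
  have h2 : ‖(w : E₁)‖ ^ 2 ≤ 0 := by nlinarith
  have h3 : ‖(w : E₁)‖ = 0 := by nlinarith [norm_nonneg (w : E₁)]
  exact Subtype.ext (norm_eq_zero.1 h3)

/-- `⟨J, C^{(k)}J⟩ = ‖TC^{(k)}J‖² ≥ 0` — the quadratic form of the propagator is the curl energy of its own minimiser (Galerkin equation at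
`v = C^{(k)}J`). [cite: BalabanImbrieJaffe1985, (4.3.3) p.311] -/
theorem inner_axialPropagator_eq {W : Submodule ℝ E₁} {T : E₁ →ₗ[ℝ] F'} (hT : ∀ w : W, T (w : E₁) = 0 → w = 0) (J : E₁) :
    ⟪J, axialPropagator W T J⟫ = ‖T (axialPropagator W T J)‖ ^ 2 := by
  have h := axialPropagator_galerkin hT J ⟨axialPropagator W T J, axialPropagator_mem W T J⟩
  rw [← real_inner_self_eq_norm_sq]
  rw [real_inner_comm]
  exact h.symm

/-- **(4.3.4)**, the norm bound, verbatim *"C^{(k)} … is bounded in norm ‖C^{(k)}‖ ≤ c (4.3.4) uniformly in k"*: from the [6II] bound (2.153)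
`γ‖B‖² ≤ ⟨B, Δ_kB⟩ = ‖TB‖²` on the constraint subspace, `‖C^{(k)}J‖ ≤ γ⁻¹‖J‖` for every source — `c = γ⁻¹`, uniform in k exactly when γ is
(γ = (γ₀/12d²)L^{−d−1} in (2.153)). [cite: BalabanImbrieJaffe1985, (4.3.4) p.311] -/
theorem norm_axialPropagator_le {W : Submodule ℝ E₁} {T : E₁ →ₗ[ℝ] F'} {γ : ℝ} (hγ : 0 < γ)
    (hcoer : ∀ w : W, γ * ‖(w : E₁)‖ ^ 2 ≤ ‖T (w : E₁)‖ ^ 2) (J : E₁) :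
    ‖axialPropagator W T J‖ ≤ γ⁻¹ * ‖J‖ := by
  have hT : ∀ w : W, T (w : E₁) = 0 → w = 0 := noZeroModes_of_coercive hγ hcoer
  set u := axialPropagator W T J with hu_def
  have hu : u ∈ W := axialPropagator_mem W T J
  have h1 : γ * ‖u‖ ^ 2 ≤ ‖T u‖ ^ 2 := hcoer ⟨u, hu⟩
  have h2 : ‖T u‖ ^ 2 = ⟪J, u⟫ := (inner_axialPropagator_eq hT J).symm
  have h3 : ⟪J, u⟫ ≤ ‖J‖ * ‖u‖ := real_inner_le_norm _ _
  have h4 : γ * ‖u‖ ^ 2 ≤ ‖J‖ * ‖u‖ := by linarith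
  by_cases hu0 : u = 0
  · rw [hu0, norm_zero]
    positivity
  · have hupos : 0 < ‖u‖ := norm_pos_iff.mpr hu0
    have h5 : γ * ‖u‖ ≤ ‖J‖ := by
      have : γ * ‖u‖ * ‖u‖ ≤ ‖J‖ * ‖u‖ := by nlinarith
      exact le_of_mul_le_mul_right this hupos
    calc ‖u‖ = γ⁻¹ * (γ * ‖u‖) := by field_simp
      _ ≤ γ⁻¹ * ‖J‖ := by gcongr

/-- **(4.3.4)** for the quadratic form: `0 ≤ ⟨J, C^{(k)}J⟩ ≤ γ⁻¹‖J‖²`. [cite: BalabanImbrieJaffe1985, (4.3.4) p.311] -/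
theorem inner_axialPropagator_le {W : Submodule ℝ E₁} {T : E₁ →ₗ[ℝ] F'} {γ : ℝ} (hγ : 0 < γ)
    (hcoer : ∀ w : W, γ * ‖(w : E₁)‖ ^ 2 ≤ ‖T (w : E₁)‖ ^ 2) (J : E₁) :
    0 ≤ ⟪J, axialPropagator W T J⟫ ∧ ⟪J, axialPropagator W T J⟫ ≤ γ⁻¹ * ‖J‖ ^ 2 := by
  have hT : ∀ w : W, T (w : E₁) = 0 → w = 0 := noZeroModes_of_coercive hγ hcoer
  refine ⟨by rw [inner_axialPropagator_eq hT]; positivity, ?_⟩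
  calc ⟪J, axialPropagator W T J⟫ ≤ ‖J‖ * ‖axialPropagator W T J‖ := real_inner_le_norm _ _
    _ ≤ ‖J‖ * (γ⁻¹ * ‖J‖) := by gcongr; exact norm_axialPropagator_le hγ hcoer J
    _ = γ⁻¹ * ‖J‖ ^ 2 := by ring

/-- **(4.3.4)** literally, as an operator-norm bound *"‖C^{(k)}‖ ≤ c"*: `‖C^{(k)}‖ ≤ γ⁻¹`. [cite: BalabanImbrieJaffe1985, (4.3.4) p.311] -/
theorem opNorm_axialPropagator_le {W : Submodule ℝ E₁} {T : E₁ →ₗ[ℝ] F'} {γ : ℝ} (hγ : 0 < γ)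
    (hcoer : ∀ w : W, γ * ‖(w : E₁)‖ ^ 2 ≤ ‖T (w : E₁)‖ ^ 2) :
    ‖LinearMap.toContinuousLinearMap (axialPropagator W T)‖ ≤ γ⁻¹ :=
  ContinuousLinearMap.opNorm_le_bound _ (by positivity) fun J => by
    rw [LinearMap.coe_toContinuousLinearMap']
    exact norm_axialPropagator_le hγ hcoer J

end Galerkin

/-! ## §1b  The same for the BIJ85 objects: `C^{(k)} = unitPropagator`, `Δ_k = deltaOp` -/

section Unit

variable {E F E₁ : Type*} [NormedAddCommGroup E] [InnerProductSpace ℝ E] [FiniteDimensional ℝ E]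
  [NormedAddCommGroup F] [InnerProductSpace ℝ F] [FiniteDimensional ℝ F]
  [NormedAddCommGroup E₁] [InnerProductSpace ℝ E₁] [FiniteDimensional ℝ E₁]

/-- The [6II] bound (2.153) in BIJ85's notation: `γ‖B‖² ≤ ⟨B, Δ_kB⟩` on the unit-lattice constraint subspace `W` IS `γ‖B‖² ≤ ‖∂H_{k,Ax}B‖²`
((4.3.2): `⟨B, Δ_kB⟩ = ‖∂H_{k,Ax}B‖²`, `inner_deltaOp`). [cite: Balaban1984PropagatorsII, (2.153) p.249] -/
theorem coercive_iff (V : Submodule ℝ E) (D : E →ₗ[ℝ] F) (Qs : E₁ →ₗ[ℝ] E) (W : Submodule ℝ E₁) (γ : ℝ) :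
    (∀ w : W, γ * ‖(w : E₁)‖ ^ 2 ≤ ⟪(w : E₁), deltaOp V D Qs (w : E₁)⟫) ↔
      ∀ w : W, γ * ‖(w : E₁)‖ ^ 2 ≤ ‖(D ∘ₗ Hop V D Qs) (w : E₁)‖ ^ 2 := by
  simp only [inner_deltaOp, LinearMap.comp_apply]

variable [MeasurableSpace E₁] [BorelSpace E₁]

/-- **(4.3.4)**, *"C^{(k)} is well defined"*: under the [6II] bound (2.153) on `W` (γ > 0) the operator formula `unitPropagator` satisfies the
defining identity (4.3.3) and `Z^{(k)} > 0` (no zero modes of `∂H_{k,Ax}` on `W` by `noZeroModes_of_coercive`; the Gaussian identity is gen 2's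
`isUnitPropagator_unitPropagator`). [cite: BalabanImbrieJaffe1985, (4.3.4) p.311] -/
theorem unitPropagator_wellDefined (V : Submodule ℝ E) (D : E →ₗ[ℝ] F) (Qs : E₁ →ₗ[ℝ] E) (W : Submodule ℝ E₁) {γ : ℝ} (hγ : 0 < γ)
    (hcoer : ∀ w : W, γ * ‖(w : E₁)‖ ^ 2 ≤ ⟪(w : E₁), deltaOp V D Qs (w : E₁)⟫) :
    IsUnitPropagator W (deltaOp V D Qs) (unitPropagator V D Qs W) ∧ 0 < unitZ W (deltaOp V D Qs) :=
  isUnitPropagator_unitPropagator V D Qs W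
    (noZeroModes_of_coercive (T := D ∘ₗ Hop V D Qs) hγ ((coercive_iff V D Qs W γ).1 hcoer))

omit [MeasurableSpace E₁] [BorelSpace E₁] in
/-- **(4.3.4)**, verbatim *"bounded in norm ‖C^{(k)}‖ ≤ c (4.3.4) uniformly in k"*, for `C^{(k)} = unitPropagator`: `‖C^{(k)}J‖ ≤ γ⁻¹‖J‖` and
`0 ≤ ⟨J, C^{(k)}J⟩ ≤ γ⁻¹‖J‖²` from the [6II] bound (2.153) `⟨B, Δ_kB⟩ ≥ γ‖B‖²` on `W`. [cite: BalabanImbrieJaffe1985, (4.3.4) p.311] -/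
theorem norm_unitPropagator_le (V : Submodule ℝ E) (D : E →ₗ[ℝ] F) (Qs : E₁ →ₗ[ℝ] E) (W : Submodule ℝ E₁) {γ : ℝ} (hγ : 0 < γ)
    (hcoer : ∀ w : W, γ * ‖(w : E₁)‖ ^ 2 ≤ ⟪(w : E₁), deltaOp V D Qs (w : E₁)⟫) (J : E₁) :
    ‖unitPropagator V D Qs W J‖ ≤ γ⁻¹ * ‖J‖ ∧
      0 ≤ ⟪J, unitPropagator V D Qs W J⟫ ∧ ⟪J, unitPropagator V D Qs W J⟫ ≤ γ⁻¹ * ‖J‖ ^ 2 := by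
  have hc := (coercive_iff V D Qs W γ).1 hcoer
  exact ⟨norm_axialPropagator_le hγ hc J, inner_axialPropagator_le hγ hc J⟩

end Unit

/-! ## §2  [6II] (2.156): `C^{(k)} = C(C*Δ_kC)⁻¹C*` for any linear parametrisation `B = CB′` of the constraint subspace -/

section Reduced

variable {E₁ F' M : Type*} [NormedAddCommGroup E₁] [InnerProductSpace ℝ E₁] [FiniteDimensional ℝ E₁]
  [NormedAddCommGroup F'] [InnerProductSpace ℝ F'] [FiniteDimensional ℝ F']
  [NormedAddCommGroup M] [InnerProductSpace ℝ M] [FiniteDimensional ℝ M]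

/-- **(2.156)** [Balaban1984PropagatorsII] p. 250, *"B = CB′, where C is a linear operator … hence C^{(k)}_Λ = C(C*Δ_kC)⁻¹C*"* — in the
Galerkin form: if `x` solves the REDUCED equation `C*Δ_kC x = C*J` (`Δ_k = T^*T`), for a linear `C` whose range is the constraint subspace `W`,
then `Cx = C^{(k)}J` (no zero modes of `T` on `W`). [cite: Balaban1984PropagatorsII, (2.156) p.250] -/
theorem axialPropagator_eq_of_reduced {W : Submodule ℝ E₁} {T : E₁ →ₗ[ℝ] F'} (hT : ∀ w : W, T (w : E₁) = 0 → w = 0)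
    (Cmap : M →ₗ[ℝ] E₁) (hCW : ∀ x, Cmap x ∈ W) (hWC : ∀ w : W, ∃ x, Cmap x = (w : E₁)) {J : E₁} {x : M}
    (hx : LinearMap.adjoint Cmap (LinearMap.adjoint T (T (Cmap x))) = LinearMap.adjoint Cmap J) :
    axialPropagator W T J = Cmap x := by
  refine galerkin_unique hT (axialPropagator_mem W T J) (hCW x) (axialPropagator_galerkin hT J) ?_
  intro v
  obtain ⟨y, hy⟩ := hWC v
  calc ⟪T (v : E₁), T (Cmap x)⟫ = ⟪Cmap y, LinearMap.adjoint T (T (Cmap x))⟫ := by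
        rw [hy, LinearMap.adjoint_inner_right]
    _ = ⟪y, LinearMap.adjoint Cmap (LinearMap.adjoint T (T (Cmap x)))⟫ := by
        rw [LinearMap.adjoint_inner_right (A := Cmap)]
    _ = ⟪y, LinearMap.adjoint Cmap J⟫ := by rw [hx]
    _ = ⟪(v : E₁), J⟫ := by rw [LinearMap.adjoint_inner_right, hy]

/-- The reduced operator `C*Δ_kC` is injective (hence invertible) when `C` is injective with range in `W` and `T` has no zero modes on `W`
— *"⟨B′, C*Δ_kCB′⟩ ≥ … ≥ γ′₀‖B′‖², (2.157)"* in qualitative form. [cite: Balaban1984PropagatorsII, (2.157) p.250] -/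
theorem reducedOp_injective {W : Submodule ℝ E₁} {T : E₁ →ₗ[ℝ] F'} (hT : ∀ w : W, T (w : E₁) = 0 → w = 0)
    (Cmap : M →ₗ[ℝ] E₁) (hCinj : Function.Injective Cmap) (hCW : ∀ x, Cmap x ∈ W) :
    Function.Injective (LinearMap.adjoint Cmap ∘ₗ (LinearMap.adjoint T ∘ₗ T) ∘ₗ Cmap) := by
  intro x₁ x₂ h
  have h0 : (LinearMap.adjoint Cmap ∘ₗ (LinearMap.adjoint T ∘ₗ T) ∘ₗ Cmap) (x₁ - x₂) = 0 := by rw [map_sub, h, sub_self]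
  have h1 : ‖T (Cmap (x₁ - x₂))‖ ^ 2 = 0 := by
    have h2 : ⟪x₁ - x₂, (LinearMap.adjoint Cmap ∘ₗ (LinearMap.adjoint T ∘ₗ T) ∘ₗ Cmap) (x₁ - x₂)⟫ = 0 := by
      rw [h0, inner_zero_right]
    simp only [LinearMap.comp_apply, LinearMap.adjoint_inner_right, real_inner_self_eq_norm_sq] at h2
    exact h2
  have h3 : T (Cmap (x₁ - x₂)) = 0 := by
    have := (pow_eq_zero_iff (n := 2) (by norm_num)).1 h1
    exact norm_eq_zero.1 this
  have h4 := hT ⟨Cmap (x₁ - x₂), hCW _⟩ h3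
  have h5 : Cmap (x₁ - x₂) = 0 := congrArg Subtype.val h4
  exact sub_eq_zero.1 (hCinj (by rw [h5, map_zero]))

end Reduced

/-! ## §3  (4.3.5)/(7.2.3): the kernel of `C^{(k)}` in coordinates is `C(CᵀΔ_kC)⁻¹Cᵀ` (2.156), and it decays exponentially by the
Sect. 5 theorem of [7] applied to `CᵀΔ_kC` -/

section Kernel

variable {n m : Type} [Fintype n] [DecidableEq n] [Fintype m] [DecidableEq m]
  {F' : Type*} [NormedAddCommGroup F'] [InnerProductSpace ℝ F'] [FiniteDimensional ℝ F']

/-- plumbing: an operator on the unit-lattice bond fields `ℝⁿ` IS the operator of its kernel `Δ(x, y) = (Δδ_y)(x)` (how a user produces the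
matrix `MΔ` of `Δ_k = T^*T` below). [cite: BalabanImbrieJaffe1985, (4.3.5) p.311] -/
theorem toEuclideanLin_of_kernel (L : EuclideanSpace ℝ n →ₗ[ℝ] EuclideanSpace ℝ n) :
    Matrix.toEuclideanLin (Matrix.of fun p q => L (EuclideanSpace.single q 1) p) = L := by
  refine (EuclideanSpace.basisFun n ℝ).toBasis.ext fun q => ?_
  rw [OrthonormalBasis.coe_toBasis, EuclideanSpace.basisFun_apply]
  ext p
  simp only [Matrix.toLpLin_apply, PiLp.toLp_apply, PiLp.ofLp_single, Matrix.mulVec_single_one]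
  rfl

/-- plumbing: over ℝ the adjoint of the operator of a matrix `C` is the operator of `Cᵀ` (`C*` of (2.156)).
[cite: Balaban1984PropagatorsII, (2.156) p.250] -/
theorem adjoint_toEuclideanLin (MC : Matrix n m ℝ) :
    LinearMap.adjoint (Matrix.toEuclideanLin MC) = Matrix.toEuclideanLin MCᵀ := by
  rw [← Matrix.conjTranspose_eq_transpose_of_trivial, Matrix.toEuclideanLin_conjTranspose_eq_adjoint]

/-- plumbing: the kernel of `Δ_k = T^*T` is symmetric (the symmetry conjunct of condition (5.6) of [7]).
[cite: Balaban1983RegularityDecay, (5.6) p.594] -/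
theorem isSymm_of_toEuclideanLin_eq {T : EuclideanSpace ℝ n →ₗ[ℝ] F'} {MΔ : Matrix n n ℝ}
    (hMΔ : Matrix.toEuclideanLin MΔ = LinearMap.adjoint T ∘ₗ T) : MΔ.IsSymm := by
  have h1 : Matrix.toEuclideanLin MΔᵀ = Matrix.toEuclideanLin MΔ := by
    rw [← adjoint_toEuclideanLin, hMΔ, LinearMap.adjoint_comp, LinearMap.adjoint_adjoint]
  exact Matrix.toEuclideanLin.injective h1

/-- **(2.156)**, the reduced equation is solvable: with `A = CᵀΔ_kC` invertible, `x = A⁻¹CᵀJ` solves `CᵀΔ_kCx = CᵀJ`.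
[cite: Balaban1984PropagatorsII, (2.156) p.250] -/
theorem reduced_solution {T : EuclideanSpace ℝ n →ₗ[ℝ] F'} {MΔ : Matrix n n ℝ}
    (hMΔ : Matrix.toEuclideanLin MΔ = LinearMap.adjoint T ∘ₗ T) (MC : Matrix n m ℝ)
    (hA : IsUnit (MCᵀ * MΔ * MC).det) (J : EuclideanSpace ℝ n) :
    LinearMap.adjoint (Matrix.toEuclideanLin MC)
        (LinearMap.adjoint T (T (Matrix.toEuclideanLin MC
          (WithLp.toLp 2 ((MCᵀ * MΔ * MC)⁻¹ *ᵥ (MCᵀ *ᵥ WithLp.ofLp J)))))) =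
      LinearMap.adjoint (Matrix.toEuclideanLin MC) J := by
  have hTT : ∀ y, LinearMap.adjoint T (T y) = Matrix.toEuclideanLin MΔ y := fun y => by
    rw [hMΔ]; rfl
  have key : ∀ w : m → ℝ, MCᵀ *ᵥ (MΔ *ᵥ (MC *ᵥ ((MCᵀ * MΔ * MC)⁻¹ *ᵥ w))) = w := fun w => by
    rw [Matrix.mulVec_mulVec, Matrix.mulVec_mulVec, Matrix.mulVec_mulVec, Matrix.mul_nonsing_inv _ hA,
      Matrix.one_mulVec]
  rw [hTT, adjoint_toEuclideanLin]
  simp only [Matrix.toLpLin_apply, key]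

/-- **(2.156)** [Balaban1984PropagatorsII] p. 250 *"C^{(k)}_Λ = C(C*Δ_kC)⁻¹C*"* for the (4.3.3) propagator in coordinates: for every
matrix `C` parametrising the constraint subspace (`B = CB′`, range exactly `W`) with `CᵀΔ_kC` invertible, `C^{(k)}J = C(CᵀΔ_kC)⁻¹CᵀJ`.
[cite: Balaban1984PropagatorsII, (2.156) p.250] -/
theorem axialPropagator_eq_2156 {W : Submodule ℝ (EuclideanSpace ℝ n)} {T : EuclideanSpace ℝ n →ₗ[ℝ] F'}
    (hT : ∀ w : W, T (w : EuclideanSpace ℝ n) = 0 → w = 0) {MΔ : Matrix n n ℝ}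
    (hMΔ : Matrix.toEuclideanLin MΔ = LinearMap.adjoint T ∘ₗ T) (MC : Matrix n m ℝ)
    (hCW : ∀ x, Matrix.toEuclideanLin MC x ∈ W)
    (hWC : ∀ w : W, ∃ x, Matrix.toEuclideanLin MC x = (w : EuclideanSpace ℝ n))
    (hA : IsUnit (MCᵀ * MΔ * MC).det) (J : EuclideanSpace ℝ n) :
    axialPropagator W T J = WithLp.toLp 2 ((MC * (MCᵀ * MΔ * MC)⁻¹ * MCᵀ) *ᵥ WithLp.ofLp J) := by
  rw [axialPropagator_eq_of_reduced hT (Matrix.toEuclideanLin MC) hCW hWC (reduced_solution hMΔ MC hA J)]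
  simp only [Matrix.toLpLin_apply, Matrix.mulVec_mulVec, Matrix.mul_assoc]

/-- **The kernel `C^{(k)}(x, y) = (C^{(k)}δ_y)(x)` of (4.3.5) IS the matrix `C(CᵀΔ_kC)⁻¹Cᵀ` of (2.156).**
[cite: Balaban1984PropagatorsII, (2.156) p.250] -/
theorem kernel_eq_2156 {W : Submodule ℝ (EuclideanSpace ℝ n)} {T : EuclideanSpace ℝ n →ₗ[ℝ] F'}
    (hT : ∀ w : W, T (w : EuclideanSpace ℝ n) = 0 → w = 0) {MΔ : Matrix n n ℝ}
    (hMΔ : Matrix.toEuclideanLin MΔ = LinearMap.adjoint T ∘ₗ T) (MC : Matrix n m ℝ)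
    (hCW : ∀ x, Matrix.toEuclideanLin MC x ∈ W)
    (hWC : ∀ w : W, ∃ x, Matrix.toEuclideanLin MC x = (w : EuclideanSpace ℝ n))
    (hA : IsUnit (MCᵀ * MΔ * MC).det) (p q : n) :
    axialPropagator W T (EuclideanSpace.single q 1) p = (MC * (MCᵀ * MΔ * MC)⁻¹ * MCᵀ) p q := by
  rw [axialPropagator_eq_2156 hT hMΔ MC hCW hWC hA]
  simp only [PiLp.ofLp_single, Matrix.mulVec_single_one]
  rfl

/-- **`CᵀΔ_kC` satisfies condition (5.6) of [7]** ([Balaban1984PropagatorsII] p. 250: *"The inequality (2.153) implies ⟨B′, C*Δ_kCB′⟩ ≥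
(γ₀/12d²)L^{−d−1}‖CB′‖² ≥ γ′₀‖B′‖², (2.157) … C is a short-ranged operator, so C*Δ_kC has the same exponential decay as Δ_k"*): from the
lower bound (2.153) `γ‖B‖² ≤ ‖TB‖² = ⟨B, Δ_kB⟩` on `W` (`hcoer`), the kernel decay of `Δ_k` (`hΔd`, positions `pos` of the bonds in any
metric space), and a parametrisation `C` with range in `W`, `‖CB′‖ ≥ ‖B′‖` (`hiso`), range ≤ r (`hrange`) and column ℓ¹-sums ≤ m_C
(`hcol`): (5.6) for `CᵀΔ_kC` on the index set of `B′` with constants `(γ, c₀e^{2δ₀r}m_C², δ₀)` (the pub-balaban cell's sandwich lemmas).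
[cite: Balaban1984PropagatorsII, (2.157) p.250] -/
theorem hyp56_reduced {X : Type} [PseudoMetricSpace X] {γ c₀ δ₀ r mC : ℝ} (hγ : 0 ≤ γ) (hc : 0 ≤ c₀) (hδ : 0 ≤ δ₀)
    {W : Submodule ℝ (EuclideanSpace ℝ n)} {T : EuclideanSpace ℝ n →ₗ[ℝ] F'}
    (hcoer : ∀ w : W, γ * ‖(w : EuclideanSpace ℝ n)‖ ^ 2 ≤ ‖T (w : EuclideanSpace ℝ n)‖ ^ 2)
    (pos : n → X) {MΔ : Matrix n n ℝ} (hMΔ : Matrix.toEuclideanLin MΔ = LinearMap.adjoint T ∘ₗ T)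
    (hΔd : ∀ p q, |MΔ p q| ≤ c₀ * Real.exp (-(δ₀ * dist (pos p) (pos q))))
    (pos' : m → X) (MC : Matrix n m ℝ) (hCW : ∀ x, Matrix.toEuclideanLin MC x ∈ W)
    (hiso : ∀ x : m → ℝ, ∑ k, x k ^ 2 ≤ ∑ p, (MC *ᵥ x) p ^ 2)
    (hrange : ∀ p k, MC p k ≠ 0 → dist (pos p) (pos' k) ≤ r)
    (hcol : ∀ k, ∑ p, |MC p k| ≤ mC) :
    B4Sect5Torus.Hyp56 (fun i j : m => dist (pos' i) (pos' j)) (MCᵀ * MΔ * MC) γ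
      (c₀ * Real.exp (2 * δ₀ * r) * mC * mC) δ₀ := by
  refine ⟨B6FromB4.sandwich_isSymm MC (isSymm_of_toEuclideanLin_eq hMΔ), ?_, ?_⟩
  · have hD : ∀ w : m → ℝ, γ * ∑ u, (MC *ᵥ w) u ^ 2 ≤ ∑ u, (MC *ᵥ w) u * (MΔ *ᵥ (MC *ᵥ w)) u := by
      intro w
      have h := hcoer ⟨Matrix.toEuclideanLin MC (WithLp.toLp 2 w), hCW _⟩
      have e1 : ‖Matrix.toEuclideanLin MC (WithLp.toLp 2 w)‖ ^ 2 = ∑ u, (MC *ᵥ w) u ^ 2 := by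
        rw [EuclideanSpace.real_norm_sq_eq]; rfl
      have e2 : ‖T (Matrix.toEuclideanLin MC (WithLp.toLp 2 w))‖ ^ 2 =
          ∑ u, (MC *ᵥ w) u * (MΔ *ᵥ (MC *ᵥ w)) u := by
        have hTT : LinearMap.adjoint T (T (Matrix.toEuclideanLin MC (WithLp.toLp 2 w))) =
            Matrix.toEuclideanLin MΔ (Matrix.toEuclideanLin MC (WithLp.toLp 2 w)) := by
          rw [hMΔ]; rfl
        rw [← real_inner_self_eq_norm_sq, ← LinearMap.adjoint_inner_right, hTT]
        simp only [Matrix.toLpLin_apply, EuclideanSpace.inner_toLp_toLp, dotProduct, star_trivial]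
        exact Finset.sum_congr rfl fun u _ => mul_comm _ _
      rw [← e1, ← e2]
      exact h
    exact fun v => B6FromB4.sandwich_lowerBound MC MΔ hγ hD hiso v
  · intro i k
    exact B6FromB4.sandwich_decay pos pos' MCᵀ MΔ MC hc hδ
      (fun i u h => by
        rw [dist_comm]
        exact hrange u i (by simpa using h))
      (fun i => by simpa using hcol i) hrange hcol hΔd i k

/-- **(4.3.5)** (= (7.2.3) p. 325), verbatim *"Furthermore C^{(k)} has a kernel which decays exponentially, uniformly in k. |C^{(k)}(x, y)| ≤
a exp(−b|x − y|). (4.3.5)"*, PROVED along the printed route *"This inequality follows from the bound (2.157) in [6II] and from the general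
theorem on unit lattice operators in [7]"*: the unit-lattice bond fields are `ℝⁿ` (`n` = bonds × components, at positions `pos` in a metric
space, `|x − y|` = `dist`), `T = ∂H_{k,Ax}` with `Δ_k = T^*T` of kernel `MΔ`, `W` the constraint subspace, `C^{(k)} = axialPropagator W T` the
(4.3.3) propagator.  HYPOTHESES OF THE PRINTED SHAPE ([6II] p. 249–250): (2.153) `γ‖B‖² ≤ ⟨B, Δ_kB⟩` on `W`; `|Δ_k(x, y)| ≤ c₀e^{−δ₀|x−y|}`;
the parametrisation `B = CB′` of `W` ((2.155): range exactly `W`, `‖CB′‖ ≥ ‖B′‖`, range ≤ r, row/column ℓ¹-sums ≤ m_C) by variables `B′`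
at positions `pos'` whose lattice sums have profile `K` (`Σ_y e^{−aρ(x,y)} ≤ K(a)`).  CONCLUSION with the constants of THE PROVED Sect. 5
theorem of [7] (`B4Sect5Torus.inv_decay`): `a = (2/γ)e^{2br}m_C²`, `b = B4Sect5Torus.rate K γ (c₀e^{2δ₀r}m_C²) δ₀ > 0`
(`B4Sect5Torus.rate_pos`) — functions of `(γ, c₀, δ₀, r, m_C, K)` only, hence *"uniformly in k"* exactly when these are.
[cite: BalabanImbrieJaffe1985, (4.3.5) p.311] -/
theorem kernel_decay {X : Type} [PseudoMetricSpace X] {K : ℝ → ℝ} (hK : ∀ a, 0 < a → 0 ≤ K a)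
    {γ c₀ δ₀ r mC : ℝ} (hγ : 0 < γ) (hc : 0 ≤ c₀) (hδ : 0 < δ₀)
    {W : Submodule ℝ (EuclideanSpace ℝ n)} {T : EuclideanSpace ℝ n →ₗ[ℝ] F'}
    (hcoer : ∀ w : W, γ * ‖(w : EuclideanSpace ℝ n)‖ ^ 2 ≤ ‖T (w : EuclideanSpace ℝ n)‖ ^ 2)
    (pos : n → X) {MΔ : Matrix n n ℝ} (hMΔ : Matrix.toEuclideanLin MΔ = LinearMap.adjoint T ∘ₗ T)
    (hΔd : ∀ p q, |MΔ p q| ≤ c₀ * Real.exp (-(δ₀ * dist (pos p) (pos q))))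
    (pos' : m → X) (MC : Matrix n m ℝ) (hCW : ∀ x, Matrix.toEuclideanLin MC x ∈ W)
    (hWC : ∀ w : W, ∃ x, Matrix.toEuclideanLin MC x = (w : EuclideanSpace ℝ n))
    (hiso : ∀ x : m → ℝ, ∑ k, x k ^ 2 ≤ ∑ p, (MC *ᵥ x) p ^ 2)
    (hrange : ∀ p k, MC p k ≠ 0 → dist (pos p) (pos' k) ≤ r)
    (hrow : ∀ p, ∑ k, |MC p k| ≤ mC) (hcol : ∀ k, ∑ p, |MC p k| ≤ mC)
    (hS : B4Sect5Torus.SumBound (fun i j : m => dist (pos' i) (pos' j)) K) (p q : n) :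
    |axialPropagator W T (EuclideanSpace.single q 1) p| ≤
      2 / γ * Real.exp (2 * B4Sect5Torus.rate K γ (c₀ * Real.exp (2 * δ₀ * r) * mC * mC) δ₀ * r) * mC * mC *
        Real.exp (-(B4Sect5Torus.rate K γ (c₀ * Real.exp (2 * δ₀ * r) * mC * mC) δ₀ * dist (pos p) (pos q))) := by
  have hT : ∀ w : W, T (w : EuclideanSpace ℝ n) = 0 → w = 0 := noZeroModes_of_coercive hγ hcoer
  have h56 := hyp56_reduced hγ.le hc hδ.le hcoer pos hMΔ hΔd pos' MC hCW hiso hrange hcol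
  have hc' : 0 ≤ c₀ * Real.exp (2 * δ₀ * r) * mC * mC := by
    rw [mul_assoc]
    exact mul_nonneg (by positivity) (mul_self_nonneg mC)
  have hρ : B4Sect5Torus.IsPseudoDist (fun i j : m => dist (pos' i) (pos' j)) :=
    ⟨fun x y => dist_comm _ _, fun x => dist_self _, fun x y z => dist_triangle _ _ _⟩
  have hAu : IsUnit (MCᵀ * MΔ * MC).det :=
    (Matrix.isUnit_iff_isUnit_det _).1 (B4Sect5Torus.isUnit_of_hyp56 hγ h56)
  have hinv := B4Sect5Torus.inv_decay hK hγ hc' hδ hρ hS h56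
  have hrate : 0 ≤ B4Sect5Torus.rate K γ (c₀ * Real.exp (2 * δ₀ * r) * mC * mC) δ₀ :=
    (B4Sect5Torus.rate_pos hK hγ hc' hδ).le
  rw [kernel_eq_2156 hT hMΔ MC hCW hWC hAu p q]
  exact B6FromB4.sandwich_decay pos' pos MC (MCᵀ * MΔ * MC)⁻¹ MCᵀ (by positivity) hrate hrange hrow
    (fun v k h => by
      rw [dist_comm]
      exact hrange k v (by simpa using h))
    (fun k => by simpa using hrow k) hinv p q

end Kernel

/-! ## §3b  (4.3.5) for the BIJ85 objects: `C^{(k)} = unitPropagator V D Qs W`, `Δ_k = deltaOp V D Qs` on `E₁ = ℝⁿ` -/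

section UnitKernel

variable {n m : Type} [Fintype n] [DecidableEq n] [Fintype m] [DecidableEq m]
  {E F : Type*} [NormedAddCommGroup E] [InnerProductSpace ℝ E] [FiniteDimensional ℝ E]
  [NormedAddCommGroup F] [InnerProductSpace ℝ F] [FiniteDimensional ℝ F]

/-- **(4.3.5)/(7.2.3) for `C^{(k)} = unitPropagator V D Qs W`** on unit-lattice bond fields `E₁ = ℝⁿ` (`Δ_k = deltaOp V D Qs` with kernel
`MΔ`; hypotheses as in `kernel_decay`, the lower bound (2.153) stated with `⟨B, Δ_kB⟩`): `|C^{(k)}(x, y)| ≤ a·e^{−b·dist(x, y)}`,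
`a = (2/γ)e^{2br}m_C²`, `b = B4Sect5Torus.rate K γ (c₀e^{2δ₀r}m_C²) δ₀`. [cite: BalabanImbrieJaffe1985, (4.3.5) p.311] -/
theorem kernel_decay_unitPropagator {X : Type} [PseudoMetricSpace X] {K : ℝ → ℝ} (hK : ∀ a, 0 < a → 0 ≤ K a)
    {γ c₀ δ₀ r mC : ℝ} (hγ : 0 < γ) (hc : 0 ≤ c₀) (hδ : 0 < δ₀)
    (V : Submodule ℝ E) (D : E →ₗ[ℝ] F) (Qs : EuclideanSpace ℝ n →ₗ[ℝ] E) (W : Submodule ℝ (EuclideanSpace ℝ n))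
    (hcoer : ∀ w : W, γ * ‖(w : EuclideanSpace ℝ n)‖ ^ 2 ≤ ⟪(w : EuclideanSpace ℝ n), deltaOp V D Qs (w : EuclideanSpace ℝ n)⟫)
    (pos : n → X) {MΔ : Matrix n n ℝ} (hMΔ : Matrix.toEuclideanLin MΔ = deltaOp V D Qs)
    (hΔd : ∀ p q, |MΔ p q| ≤ c₀ * Real.exp (-(δ₀ * dist (pos p) (pos q))))
    (pos' : m → X) (MC : Matrix n m ℝ) (hCW : ∀ x, Matrix.toEuclideanLin MC x ∈ W)
    (hWC : ∀ w : W, ∃ x, Matrix.toEuclideanLin MC x = (w : EuclideanSpace ℝ n))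
    (hiso : ∀ x : m → ℝ, ∑ k, x k ^ 2 ≤ ∑ p, (MC *ᵥ x) p ^ 2)
    (hrange : ∀ p k, MC p k ≠ 0 → dist (pos p) (pos' k) ≤ r)
    (hrow : ∀ p, ∑ k, |MC p k| ≤ mC) (hcol : ∀ k, ∑ p, |MC p k| ≤ mC)
    (hS : B4Sect5Torus.SumBound (fun i j : m => dist (pos' i) (pos' j)) K) (p q : n) :
    |unitPropagator V D Qs W (EuclideanSpace.single q 1) p| ≤
      2 / γ * Real.exp (2 * B4Sect5Torus.rate K γ (c₀ * Real.exp (2 * δ₀ * r) * mC * mC) δ₀ * r) * mC * mC *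
        Real.exp (-(B4Sect5Torus.rate K γ (c₀ * Real.exp (2 * δ₀ * r) * mC * mC) δ₀ * dist (pos p) (pos q))) :=
  kernel_decay hK hγ hc hδ ((coercive_iff V D Qs W γ).1 hcoer) pos hMΔ hΔd pos' MC hCW hWC hiso hrange hrow hcol hS p q

/-- **(2.156) for `unitPropagator`**: `C^{(k)}(x, y) = (C(CᵀΔ_kC)⁻¹Cᵀ)(x, y)` with `Δ_k = deltaOp V D Qs` of kernel `MΔ`, for every
parametrisation `C` of `W` with `CᵀΔ_kC` invertible (no zero modes of `∂H_{k,Ax}` on `W`). [cite: Balaban1984PropagatorsII, (2.156) p.250] -/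
theorem kernel_unitPropagator_eq_2156 (V : Submodule ℝ E) (D : E →ₗ[ℝ] F) (Qs : EuclideanSpace ℝ n →ₗ[ℝ] E)
    (W : Submodule ℝ (EuclideanSpace ℝ n)) (hT : ∀ w : W, D (Hop V D Qs (w : EuclideanSpace ℝ n)) = 0 → w = 0)
    {MΔ : Matrix n n ℝ} (hMΔ : Matrix.toEuclideanLin MΔ = deltaOp V D Qs) (MC : Matrix n m ℝ)
    (hCW : ∀ x, Matrix.toEuclideanLin MC x ∈ W)
    (hWC : ∀ w : W, ∃ x, Matrix.toEuclideanLin MC x = (w : EuclideanSpace ℝ n))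
    (hA : IsUnit (MCᵀ * MΔ * MC).det) (p q : n) :
    unitPropagator V D Qs W (EuclideanSpace.single q 1) p = (MC * (MCᵀ * MΔ * MC)⁻¹ * MCᵀ) p q :=
  kernel_eq_2156 (T := D ∘ₗ Hop V D Qs) hT hMΔ MC hCW hWC hA p q

end UnitKernel

/-! ## §4  Knitting to the typed decls of record (r15): `BIJ85Sect4Statements.GaugeRG.Ineq434/Ineq435`, `BIJ85Sect7Statements.KernelData.Ineq723` -/

section Record

variable {F' : Type*} [NormedAddCommGroup F'] [InnerProductSpace ℝ F'] [FiniteDimensional ℝ F']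

/-- **Row C1.Eq4.3.4 for the typed carrier**: whenever the carrier's `‖C^{(k)}‖` IS the operator norm of the (4.3.3) propagator on a
constraint subspace `W` where the [6II] bound (2.153) `γ‖B‖² ≤ ⟨B, Δ_kB⟩ = ‖TB‖²` holds, r15's `GaugeRG.Ineq434` holds with `c = γ⁻¹`.
[cite: BalabanImbrieJaffe1985, (4.3.4) p.311] -/
theorem ineq434_of_opNorm (S : BIJ85Sect4Statements.GaugeRG) {E₁ : Type*} [NormedAddCommGroup E₁] [InnerProductSpace ℝ E₁]
    [FiniteDimensional ℝ E₁] {W : Submodule ℝ E₁} {T : E₁ →ₗ[ℝ] F'} {γ : ℝ} (hγ : 0 < γ)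
    (hcoer : ∀ w : W, γ * ‖(w : E₁)‖ ^ 2 ≤ ‖T (w : E₁)‖ ^ 2)
    (hnorm : S.normCk = ‖LinearMap.toContinuousLinearMap (axialPropagator W T)‖) : S.Ineq434 γ⁻¹ := by
  unfold BIJ85Sect4Statements.GaugeRG.Ineq434
  rw [hnorm]
  exact opNorm_axialPropagator_le hγ hcoer

/-- **Row C1.Eq4.3.5 for the typed carrier**: whenever the carrier's kernel `C^{(k)}(x, y)` IS the kernel of the (4.3.3) propagator in the
bond coordinates `ℝ^{BondU}` and `|x − y|` the distance of the bond positions, r15's `GaugeRG.Ineq435 a b` holds with the constants of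
`kernel_decay` (hypotheses of the printed shape as there). [cite: BalabanImbrieJaffe1985, (4.3.5) p.311] -/
theorem ineq435_of_kernel (S : BIJ85Sect4Statements.GaugeRG) [Fintype S.BondU] [DecidableEq S.BondU]
    {m : Type} [Fintype m] [DecidableEq m] {X : Type} [PseudoMetricSpace X] {K : ℝ → ℝ} (hK : ∀ a, 0 < a → 0 ≤ K a)
    {γ c₀ δ₀ r mC : ℝ} (hγ : 0 < γ) (hc : 0 ≤ c₀) (hδ : 0 < δ₀)
    {W : Submodule ℝ (EuclideanSpace ℝ S.BondU)} {T : EuclideanSpace ℝ S.BondU →ₗ[ℝ] F'}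
    (hcoer : ∀ w : W, γ * ‖(w : EuclideanSpace ℝ S.BondU)‖ ^ 2 ≤ ‖T (w : EuclideanSpace ℝ S.BondU)‖ ^ 2)
    (pos : S.BondU → X) {MΔ : Matrix S.BondU S.BondU ℝ} (hMΔ : Matrix.toEuclideanLin MΔ = LinearMap.adjoint T ∘ₗ T)
    (hΔd : ∀ p q, |MΔ p q| ≤ c₀ * Real.exp (-(δ₀ * dist (pos p) (pos q))))
    (pos' : m → X) (MC : Matrix S.BondU m ℝ) (hCW : ∀ x, Matrix.toEuclideanLin MC x ∈ W)
    (hWC : ∀ w : W, ∃ x, Matrix.toEuclideanLin MC x = (w : EuclideanSpace ℝ S.BondU))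
    (hiso : ∀ x : m → ℝ, ∑ k, x k ^ 2 ≤ ∑ p, (MC *ᵥ x) p ^ 2)
    (hrange : ∀ p k, MC p k ≠ 0 → dist (pos p) (pos' k) ≤ r)
    (hrow : ∀ p, ∑ k, |MC p k| ≤ mC) (hcol : ∀ k, ∑ p, |MC p k| ≤ mC)
    (hS : B4Sect5Torus.SumBound (fun i j : m => dist (pos' i) (pos' j)) K)
    (hCk : ∀ x y, S.Ck x y = axialPropagator W T (EuclideanSpace.single y 1) x)
    (hdist : ∀ x y, S.distU x y = dist (pos x) (pos y)) :
    S.Ineq435 (2 / γ * Real.exp (2 * B4Sect5Torus.rate K γ (c₀ * Real.exp (2 * δ₀ * r) * mC * mC) δ₀ * r) * mC * mC)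
      (B4Sect5Torus.rate K γ (c₀ * Real.exp (2 * δ₀ * r) * mC * mC) δ₀) := by
  intro x y
  rw [hCk, hdist]
  exact kernel_decay hK hγ hc hδ hcoer pos hMΔ hΔd pos' MC hCW hWC hiso hrange hrow hcol hS x y

/-- **Row C1.Eq7.2.3 (its derivation sentence) for the typed carrier**: whenever `C^{(k)}_{μν}(x, y)` IS the kernel of the (4.3.3) propagator
at the bonds `(x, μ)`, `(y, ν)` (bond positions = site positions) and `|x − y|` the site distance, r15's `KernelData.Ineq723 M δ` holds with
the constants of `kernel_decay` — *"This inequality follows from the bound (2.157) in [6II] and from the general theorem on unit lattice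
operators in [7]"*. [cite: BalabanImbrieJaffe1985, (7.2.3) p.325] -/
theorem ineq723_of_kernel (Kd : BIJ85Sect7Statements.KernelData) {n m : Type} [Fintype n] [DecidableEq n] [Fintype m]
    [DecidableEq m] {X : Type} [PseudoMetricSpace X] {K : ℝ → ℝ} (hK : ∀ a, 0 < a → 0 ≤ K a)
    {γ c₀ δ₀ r mC : ℝ} (hγ : 0 < γ) (hc : 0 ≤ c₀) (hδ : 0 < δ₀)
    {W : Submodule ℝ (EuclideanSpace ℝ n)} {T : EuclideanSpace ℝ n →ₗ[ℝ] F'}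
    (hcoer : ∀ w : W, γ * ‖(w : EuclideanSpace ℝ n)‖ ^ 2 ≤ ‖T (w : EuclideanSpace ℝ n)‖ ^ 2)
    (pos : n → X) {MΔ : Matrix n n ℝ} (hMΔ : Matrix.toEuclideanLin MΔ = LinearMap.adjoint T ∘ₗ T)
    (hΔd : ∀ p q, |MΔ p q| ≤ c₀ * Real.exp (-(δ₀ * dist (pos p) (pos q))))
    (pos' : m → X) (MC : Matrix n m ℝ) (hCW : ∀ x, Matrix.toEuclideanLin MC x ∈ W)
    (hWC : ∀ w : W, ∃ x, Matrix.toEuclideanLin MC x = (w : EuclideanSpace ℝ n))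
    (hiso : ∀ x : m → ℝ, ∑ k, x k ^ 2 ≤ ∑ p, (MC *ᵥ x) p ^ 2)
    (hrange : ∀ p k, MC p k ≠ 0 → dist (pos p) (pos' k) ≤ r)
    (hrow : ∀ p, ∑ k, |MC p k| ≤ mC) (hcol : ∀ k, ∑ p, |MC p k| ≤ mC)
    (hS : B4Sect5Torus.SumBound (fun i j : m => dist (pos' i) (pos' j)) K)
    (bond : Kd.Dir → Kd.SiteU → n) (site : Kd.SiteU → X) (hpos : ∀ μ x, pos (bond μ x) = site x)
    (hC : ∀ μ ν x y, Kd.C μ ν x y = axialPropagator W T (EuclideanSpace.single (bond ν y) 1) (bond μ x))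
    (hdist : ∀ x y, Kd.distU x y = dist (site x) (site y)) :
    Kd.Ineq723 (2 / γ * Real.exp (2 * B4Sect5Torus.rate K γ (c₀ * Real.exp (2 * δ₀ * r) * mC * mC) δ₀ * r) * mC * mC)
      (B4Sect5Torus.rate K γ (c₀ * Real.exp (2 * δ₀ * r) * mC * mC) δ₀) := by
  intro μ ν x y
  rw [hC, hdist, ← hpos μ x, ← hpos ν y]
  exact kernel_decay hK hγ hc hδ hcoer pos hMΔ hΔd pos' MC hCW hWC hiso hrange hrow hcol hS (bond μ x) (bond ν y)

end Record

/-! ## §5  (v1.1) p. 325, the sentence after (7.2.3): *"In fact this inequality also holds for propagators with Dirichlet boundary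
conditions outside a domain Λ, uniformly in Λ."* — restricting the parametrising variables `B′` to any subset `Λ′` ([6II] (2.156) with
`Λ`: `C^{(k)}_Λ = C_Λ(C_Λ^*Δ_kC_Λ)⁻¹C_Λ^*`, `C_Λ` = the columns of `C` in `Λ′`; for the block-local `C` of (2.155) this is the propagator of
the fields supported in the union of blocks `Λ`) gives the propagator of the subspace `C(ℝ^{Λ′}) ⊆ W` with THE SAME constants `(a, b)`:
the reduced operator is the compression `(CᵀΔ_kC)_{Λ′}` and the Sect. 5 theorem of [7] is uniform over compressions
(`B4Sect5Torus.inv_submatrix_decay`). -/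

section Dirichlet

variable {n m m' : Type} [Fintype n] [DecidableEq n] [Fintype m] [DecidableEq m] [Fintype m'] [DecidableEq m']
  {F' : Type*} [NormedAddCommGroup F'] [InnerProductSpace ℝ F'] [FiniteDimensional ℝ F']

omit [DecidableEq n] [Fintype m] [DecidableEq m] [Fintype m'] [DecidableEq m'] in
/-- plumbing for (2.156)_Λ: the reduced operator of the sub-parametrisation `C_Λ` (columns `e : Λ′ ↪ B′`) is the compression
`(CᵀΔ_kC)_{Λ′}`. [cite: Balaban1984PropagatorsII, (2.156) p.250] -/
theorem subparam_reduced (MC : Matrix n m ℝ) (MΔ : Matrix n n ℝ) (e : m' → m) :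
    (MC.submatrix id e)ᵀ * MΔ * MC.submatrix id e = (MCᵀ * MΔ * MC).submatrix e e := by
  ext i j
  simp only [Matrix.mul_apply, Matrix.submatrix_apply, Matrix.transpose_apply, id]

omit [Fintype n] [DecidableEq n] [DecidableEq m] [DecidableEq m'] in
/-- plumbing for (2.156)_Λ: `C_Λx = C(x extended by zero)`, so `C_Λ(ℝ^{Λ′}) ⊆ C(ℝ^{B′}) ⊆ W`. [cite: Balaban1984PropagatorsII, (2.156) p.250] -/
theorem subparam_mulVec (MC : Matrix n m ℝ) {e : m' → m} (he : Function.Injective e) (x : m' → ℝ) :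
    MC.submatrix id e *ᵥ x = MC *ᵥ Function.extend e x 0 := by
  ext p
  simp only [Matrix.mulVec, dotProduct, Matrix.submatrix_apply, id]
  rw [B4Sect5Torus.sum_eq_sum_range he (fun k => MC p k * Function.extend e x 0 k)
    (fun k hk => by rw [Function.extend_apply' _ _ _ hk, Pi.zero_apply, mul_zero])]
  simp only [he.extend_apply]

/-- **(4.3.5)/(7.2.3) *"uniformly in Λ"*** ([BalabanImbrieJaffe1985] p. 325: *"In fact this inequality also holds for propagators with Dirichlet
boundary conditions outside a domain Λ, uniformly in Λ"*; [Balaban1984PropagatorsII] (2.156) `C^{(k)}_Λ = C(C*Δ_kC)⁻¹C*` on Λ): under the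
hypotheses of `kernel_decay`, for EVERY subset `Λ′` of the parametrising variables (injection `e`), the (4.3.3) propagator of the subspace
`C(ℝ^{Λ′}) ⊆ W` — the fields `B = CB′` with `B′` supported in `Λ′` — obeys `|C^{(k)}_Λ(x, y)| ≤ a·e^{−b·dist(x, y)}` with THE SAME
`a = (2/γ)e^{2br}m_C²`, `b = B4Sect5Torus.rate K γ (c₀e^{2δ₀r}m_C²) δ₀` as `kernel_decay` (the reduced operator is the compression
`(CᵀΔ_kC)_{Λ′}`, `subparam_reduced`, and the Sect. 5 theorem of [7] holds for all compressions with the same constants,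
`B4Sect5Torus.inv_submatrix_decay`). [cite: BalabanImbrieJaffe1985, (7.2.3) p.325] -/
theorem kernel_decay_dirichlet {X : Type} [PseudoMetricSpace X] {K : ℝ → ℝ} (hK : ∀ a, 0 < a → 0 ≤ K a)
    {γ c₀ δ₀ r mC : ℝ} (hγ : 0 < γ) (hc : 0 ≤ c₀) (hδ : 0 < δ₀)
    {W : Submodule ℝ (EuclideanSpace ℝ n)} {T : EuclideanSpace ℝ n →ₗ[ℝ] F'}
    (hcoer : ∀ w : W, γ * ‖(w : EuclideanSpace ℝ n)‖ ^ 2 ≤ ‖T (w : EuclideanSpace ℝ n)‖ ^ 2)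
    (pos : n → X) {MΔ : Matrix n n ℝ} (hMΔ : Matrix.toEuclideanLin MΔ = LinearMap.adjoint T ∘ₗ T)
    (hΔd : ∀ p q, |MΔ p q| ≤ c₀ * Real.exp (-(δ₀ * dist (pos p) (pos q))))
    (pos' : m → X) (MC : Matrix n m ℝ) (hCW : ∀ x, Matrix.toEuclideanLin MC x ∈ W)
    (hiso : ∀ x : m → ℝ, ∑ k, x k ^ 2 ≤ ∑ p, (MC *ᵥ x) p ^ 2)
    (hrange : ∀ p k, MC p k ≠ 0 → dist (pos p) (pos' k) ≤ r)
    (hrow : ∀ p, ∑ k, |MC p k| ≤ mC) (hcol : ∀ k, ∑ p, |MC p k| ≤ mC)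
    (hS : B4Sect5Torus.SumBound (fun i j : m => dist (pos' i) (pos' j)) K)
    {e : m' → m} (he : Function.Injective e) (p q : n) :
    |axialPropagator (LinearMap.range (Matrix.toEuclideanLin (MC.submatrix id e))) T (EuclideanSpace.single q 1) p| ≤
      2 / γ * Real.exp (2 * B4Sect5Torus.rate K γ (c₀ * Real.exp (2 * δ₀ * r) * mC * mC) δ₀ * r) * mC * mC *
        Real.exp (-(B4Sect5Torus.rate K γ (c₀ * Real.exp (2 * δ₀ * r) * mC * mC) δ₀ * dist (pos p) (pos q))) := by
  set W' : Submodule ℝ (EuclideanSpace ℝ n) := LinearMap.range (Matrix.toEuclideanLin (MC.submatrix id e)) with hW'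
  -- the subspace C(ℝ^{Λ′}) lies in W, so (2.153) restricts to it
  have hle : W' ≤ W := by
    rintro v ⟨x, rfl⟩
    have h1 : Matrix.toEuclideanLin (MC.submatrix id e) x =
        Matrix.toEuclideanLin MC (WithLp.toLp 2 (Function.extend e (WithLp.ofLp x) 0)) := by
      simp only [Matrix.toLpLin_apply, subparam_mulVec MC he]
    rw [h1]
    exact hCW _
  have hcoer' : ∀ w : W', γ * ‖(w : EuclideanSpace ℝ n)‖ ^ 2 ≤ ‖T (w : EuclideanSpace ℝ n)‖ ^ 2 :=
    fun w => hcoer ⟨w, hle w.2⟩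
  have hT' : ∀ w : W', T (w : EuclideanSpace ℝ n) = 0 → w = 0 := noZeroModes_of_coercive hγ hcoer'
  have hCW' : ∀ x, Matrix.toEuclideanLin (MC.submatrix id e) x ∈ W' := fun x => LinearMap.mem_range_self _ x
  have hWC' : ∀ w : W', ∃ x, Matrix.toEuclideanLin (MC.submatrix id e) x = (w : EuclideanSpace ℝ n) :=
    fun w => LinearMap.mem_range.1 w.2
  -- (5.6) for CᵀΔ_kC, hence for its compression; invertibility and the UNIFORM inverse decay of [7] Sect. 5
  have h56 := hyp56_reduced hγ.le hc hδ.le hcoer pos hMΔ hΔd pos' MC hCW hiso hrange hcol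
  have hc' : 0 ≤ c₀ * Real.exp (2 * δ₀ * r) * mC * mC := by
    rw [mul_assoc]
    exact mul_nonneg (by positivity) (mul_self_nonneg mC)
  have hρ : B4Sect5Torus.IsPseudoDist (fun i j : m => dist (pos' i) (pos' j)) :=
    ⟨fun x y => dist_comm _ _, fun x => dist_self _, fun x y z => dist_triangle _ _ _⟩
  have h56' := B4Sect5Torus.hyp56_submatrix h56 he
  have hAu : IsUnit ((MC.submatrix id e)ᵀ * MΔ * MC.submatrix id e).det := by
    rw [subparam_reduced]
    exact (Matrix.isUnit_iff_isUnit_det _).1 (B4Sect5Torus.isUnit_of_hyp56 hγ h56')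
  have hinv := B4Sect5Torus.inv_submatrix_decay hK hγ hc' hδ hρ hS h56 he
  have hrate : 0 ≤ B4Sect5Torus.rate K γ (c₀ * Real.exp (2 * δ₀ * r) * mC * mC) δ₀ :=
    (B4Sect5Torus.rate_pos hK hγ hc' hδ).le
  -- the short-range data of C restrict to the columns in Λ′
  have hrange' : ∀ p k, MC.submatrix id e p k ≠ 0 → dist (pos p) (pos' (e k)) ≤ r := fun p k h => hrange p (e k) h
  have hrow' : ∀ p, ∑ k, |MC.submatrix id e p k| ≤ mC := by
    intro p
    have h1 : ∑ k, |MC.submatrix id e p k| = ∑ k ∈ Finset.univ.map ⟨e, he⟩, |MC p k| := by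
      rw [Finset.sum_map]; rfl
    rw [h1]
    exact (Finset.sum_le_sum_of_subset_of_nonneg (Finset.subset_univ _) (fun _ _ _ => abs_nonneg _)).trans (hrow p)
  rw [kernel_eq_2156 hT' hMΔ (MC.submatrix id e) hCW' hWC' hAu p q, subparam_reduced]
  exact B6FromB4.sandwich_decay (fun k => pos' (e k)) pos (MC.submatrix id e) ((MCᵀ * MΔ * MC).submatrix e e)⁻¹
    (MC.submatrix id e)ᵀ (by positivity) hrate hrange' hrow'
    (fun v k h => by
      rw [dist_comm]
      exact hrange' k v (by simpa using h))
    (fun k => by simpa using hrow' k) hinv p q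

/-- **(4.3.4) uniformly in Λ**: the norm bound `‖C^{(k)}_ΛJ‖ ≤ γ⁻¹‖J‖` for the propagator of every subspace `W′ ≤ W` (in particular
`C(ℝ^{Λ′})`), with the same `c = γ⁻¹` — (2.153) restricts to subspaces. [cite: BalabanImbrieJaffe1985, (4.3.4) p.311] -/
theorem norm_axialPropagator_le_of_le {E₁ : Type*} [NormedAddCommGroup E₁] [InnerProductSpace ℝ E₁] [FiniteDimensional ℝ E₁]
    {W W' : Submodule ℝ E₁} (hle : W' ≤ W) {T : E₁ →ₗ[ℝ] F'} {γ : ℝ} (hγ : 0 < γ)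
    (hcoer : ∀ w : W, γ * ‖(w : E₁)‖ ^ 2 ≤ ‖T (w : E₁)‖ ^ 2) (J : E₁) :
    ‖axialPropagator W' T J‖ ≤ γ⁻¹ * ‖J‖ :=
  norm_axialPropagator_le hγ (fun w => hcoer ⟨w, hle w.2⟩) J

end Dirichlet

end

end Literature.MathematicalPhysics.QuantumFieldTheory.BalabanImbrieJaffe1984to88.BIJ85Ineq434Proof
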